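import Literature.AnabelianGeometry.EtaleTheta.GalSectDotCCuspDecompCriterion
import Literature.AnabelianGeometry.EtaleTheta.SettingModelKrullMuTwoInversion
import HarnessLib

/-!
# The `DotCCusp` splitting criterion PASSES at the COMMUTATOR-AXIS cusp: `MuTwoSetting.inversionModelκ′` (abc-iut-L2-t10's Krull model)

S. Mochizuki, *The étale theta function …* [EtTh], Publ. RIMS **45** (2009), Def. 1.7 p. 27 («`Ẍ^log → X^log` … the Galois covering of degree
4 determined by the multiplication by 2 map»), §2 p. 35 («`x` the unique cusp of `X^log` … `I_x`»), Thm. 1.10 (iii) p. 30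
[cite: MochizukiEtTh2009, Def 1.7 p.27].  abc-iut cell, layer L2, seat abc-iut-w5-d029 (gen 5); NV-L2 census rows `MuTwoSetting.DotCCusp` /
`DotCCuspTorsor`; L2-lead R226 (b1) / R291.  PROOF-ONLY (0 definitions): the POSITIVE companion of this seat's NEGATIVE certificates
`GalSectDotCCuspDecompCriterionTate` (p443644) / `…ChiInv` (p445383).

This seat's criterion (`GalSectDotCCuspDecompCriterion`, p443221): a `DotCCusp` over `(M, ε_Z)` forces every `d ∈ D_x` into `Π^tp_Ẍ ∪ Π^tp_Ẍ·ε_Z`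
(the cusp below splits in `Ẋ → X`).  At the Tate-twisted `b`-axis cusps this FAILS (`b ∈ D_x` has the parity of `ε_μ`).  At abc-iut-L2-t10's
cusped Krull model `MuTwoSetting.inversionModelκ′ p` (`SettingModelKrullMuTwoInversion`, p445523: untwisted Krull carrier, ONE cusp on print's COMMUTATOR
AXIS `c^Ẑ = ⁅a,b⁆^Ẑ` — abc-iut-w5-d165's `cAxisGfp` —, `Π^tp_Ẍ := Ker parityκ`, `ε_μ := b`, genuine inversion) it PASSES in the strongest form:
**`cuspDecompκ_le_Xddκ`** — the WHOLE decomposition group `D_x = c^Ẑ ⋊ G_{ℚ_p}` lies in `Π^tp_Ẍ` (`ĥ₂(c^t) = (0, 0, t)` has `x = y = 0`; the Galois factor has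
parity `0`), i.e. the cusp SPLITS COMPLETELY in `Ẍ → X` — exactly print's situation (`Ẍ → X` étale over the cusp, all of `E[2]` rational since `K = K̈`).
Hence `decomp_le_GtpXdd_inversionModelκ'` and the criterion's conclusion `splittingCriterion_inversionModelκ'` for EVERY `ε_Z` (no admissibility needed).

WHAT THIS DOES NOT DO (honest scope): it does not construct a `DotCCusp` at `inversionModelκ′` — the remaining fields are DATA the criterion does not
touch: the cuspidal pair of `Ċ` in `Π^tp_C` with `I = D ∩ Δ^tp_C`, and above all `torsor : pair.TorsorData (GalSect.KxHat _)` — a free transitive action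
of the REAL `(K^×)^∧ = ProfiniteCompletion (K^×)` on the splitting classes, i.e. a bijection `SplittingClass ≃ (K^×)^∧`: at any model this is the Kummer
identification «`H¹(G_K, Ẑ(1)) ≅ (K^×)^∧`» in DATA form (the K2 closer's binder (gen); census C7 «future» clause `kummer`), not a group-theoretic
triviality — so the census rows DotCCusp / DotCCuspTorsor stay at 0 producers until that identification is supplied, even at the commutator-axis carrier.
READING for R291: the axis obstruction is absent on the commutator axis; the torsor field is the next (and model-independent) obstruction.

Semi-synthetic model; consistency evidence for the typed interfaces only; nothing of [EtTh] asserted; no side taken on [IUTchIII] Cor. 3.12; typed ≠ proved.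
-/

noncomputable section

namespace Literature.AnabelianGeometry.EtaleTheta.SettingModel

open Literature.AnabelianGeometry.SemiGraphs
open scoped Pointwise

variable (p : ℕ) [Fact p.Prime]

/-- `c^t ∈ Δ^tp_Ẍ` for every `t ∈ Ẑ`: the commutator axis has even (indeed zero) `a`- and `b`-parity (`ĥ₂(c^t) = (0, 0, t mod 2)`).
[cite: MochizukiEtTh2009, Def 1.7 p.27] -/
theorem cPowGfp_mem_dXdd (t : ZH) : cPowGfp t ∈ dXdd := by
  rw [mem_dXdd_iff]
  have h : levelHom 2 (cPowGfp t) = ⟨0, 0, Multiplicative.toAdd (modN 2 t)⟩ := by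
    change hHat 2 (gfpFst (cPowGfp t)) = _
    rw [gfpFst_cPowGfp, hHat_cPow]
  rw [h]
  exact ⟨rfl, rfl⟩

/-- The commutator axis of `Γ` lies in `Δ^tp_Ẍ`. [cite: MochizukiEtTh2009, Def 1.7 p.27] -/
theorem cAxisGfp_le_dXdd : cAxisGfp ≤ dXdd := by
  rintro _ ⟨t, rfl⟩
  exact cPowGfp_mem_dXdd t

/-- **`D_x = c^Ẑ ⋊ G_{ℚ_p} ≤ Π^tp_Ẍ` at the cusped Krull model**: the commutator-axis cusp SPLITS COMPLETELY in `Ẍ → X`.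
[cite: MochizukiEtTh2009, Def 1.7 p.27] -/
theorem cuspDecompκ_le_Xddκ : cuspDecompκ p ≤ Xddκ p := fun g hg =>
  (mem_Xddκ_iff p g).mpr (cAxisGfp_le_dXdd ((mem_cuspDecompκ_iff p g).mp hg))

/-- The same read at the Def. 1.7 record: `M.decomp x ≤ M.GtpXdd` for `M := MuTwoSetting.inversionModelκ′ p`.
[cite: MochizukiEtTh2009, Def 1.7 p.27] -/
theorem decomp_le_GtpXdd_inversionModelκ' (x : (MuTwoSetting.inversionModelκ' p).Pt) :
    (MuTwoSetting.inversionModelκ' p).decomp x ≤ (MuTwoSetting.inversionModelκ' p).GtpXdd :=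
  cuspDecompκ_le_Xddκ p

/-- Hence every conjugate `g·D_x·g⁻¹` lies in `Π^tp_Ẍ` too (`Π^tp_Ẍ ⊴ Π^tp_X`). [cite: MochizukiEtTh2009, Def 1.7 p.27] -/
theorem conj_decomp_le_GtpXdd_inversionModelκ' (g : (MuTwoSetting.inversionModelκ' p).PiTemp)
    (x : (MuTwoSetting.inversionModelκ' p).Pt) :
    MulAut.conj g • (MuTwoSetting.inversionModelκ' p).decomp x ≤ (MuTwoSetting.inversionModelκ' p).GtpXdd := by
  haveI := (MuTwoSetting.inversionModelκ' p).GtpXdd_normal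
  rintro _ ⟨d, hd, rfl⟩
  exact Subgroup.Normal.conj_mem inferInstance d (decomp_le_GtpXdd_inversionModelκ' p x hd) g

/-- **The conclusion of the `DotCCusp` splitting criterion HOLDS at `inversionModelκ′` for EVERY `ε_Z = inclX z`** (left disjunct,
no admissibility needed) — the necessary condition that FAILS at the `b`-axis cusps is met on the commutator axis.
[cite: MochizukiEtTh2009, Thm 1.10 (iii) p.30] -/
theorem splittingCriterion_inversionModelκ' (z : (MuTwoSetting.inversionModelκ' p).PiTemp)
    (x : (MuTwoSetting.inversionModelκ' p).Pt) :
    ∀ d ∈ (MuTwoSetting.inversionModelκ' p).decomp x,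
      d ∈ (MuTwoSetting.inversionModelκ' p).GtpXdd ∨ d * z⁻¹ ∈ (MuTwoSetting.inversionModelκ' p).GtpXdd :=
  fun _ hd => Or.inl (decomp_le_GtpXdd_inversionModelκ' p x hd)

/-- **Census form (R291 / rows DotCCusp, DotCCuspTorsor)**: there is a `MuTwoSetting` with the guard, a CUSP and an admissible `ε_Z` whose cusp
decomposition group lies ENTIRELY in `Π^tp_Ẍ` — the axis obstruction of the `b`-axis models is absent on the commutator axis (what a `DotCCusp`
there still needs is the `(K^×)^∧`-torsor DATA, see the module docstring). [cite: MochizukiEtTh2009, Thm 1.10 (iii) p.30] -/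
theorem _root_.Literature.AnabelianGeometry.EtaleTheta.MuTwoSetting.exists_isCusp_and_decomp_le_GtpXdd :
    ∃ M : MuTwoSetting p, M.toThetaSetting.IsEtThOrigin ∧ (∃ εZ : M.GtpC, M.IsAdmissibleEpsZ εZ) ∧
      ∃ x : M.Pt, M.IsCusp x ∧ M.decomp x ≤ M.GtpXdd :=
  ⟨MuTwoSetting.inversionModelκ' p, MuTwoSetting.inversionModelκ'_isEtThOrigin p, ⟨_, MuTwoSetting.inversionModelκ'_isAdmissibleEpsZ p⟩,
    (), trivial, decomp_le_GtpXdd_inversionModelκ' p ()⟩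

end Literature.AnabelianGeometry.EtaleTheta.SettingModel

end
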